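import Summits.Ventures.DiscreteObjects.PP12.FlagSevenEntriesA
import Summits.Ventures.DiscreteObjects.PP12.FlagSevenEntriesB
import Summits.Ventures.DiscreteObjects.PP12.FlagSevenShapes

/-!
# PP(12), flag sub-cell `f = 7`: the ORBIT-MATRIX REDUCTION holds (kernel; Step D₂ — row and column sums, assembly)
Framing: lottery ticket; floor = certified bounds/negative ranges.

Cell pub-namedobj (venture DiscreteObjects), target (M), designs gen 14. For `D := flagSevenDataOfPlane …` (orbit data READ OFF a putative projective
plane of order 12 with a flag-type collineation `σ`, `σ³ = 1`, exactly 7 fixed points; `FlagSevenOrbitDataOfPlane`): `entry_eq_card` (every entry of the typed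
matrix is the incidence count `|colOrbit c ∩ lineRep r|`, `FlagSevenEntriesA/B`); `sum_colOrbit` / `sum_rowOrbit` (sums over `F7Col` / `F7Row` are sums over the
non-trivial orbits, `FlagSevenColOrbits` / `FlagSevenRowOrbits`); conjunct 6 `flagSevenDataOfPlane_rows` = `OrbitSideIdentities.orbit_row_identity_orbits` with
the common fixed points of the two representative lines counted by type (`c` for two c-lines, `y_k` for two T-lines through `y_k`, none otherwise); conjunct 7
`flagSevenDataOfPlane_cols` dually (`orbit_column_identity_orbits`, incidence symmetry `entry_eq_card_lines`); **`isFlagSevenOrbitMatrix_dataOfPlane`** and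
**`flagSevenOrbitReduction_holds : FlagSevenOrbitReduction`** (designs g13's typed statement p327216 is a theorem); `noFlagSevenFixed_of_noOrbitMatrix :
NoFlagSevenOrbitMatrix → NoFlagOrder3Order12Fixed 7`. CENSUS STATUS: `NoFlagSevenOrbitMatrix` is UNDECIDED (designs g12/g13; SAT spec FAMILY-FLAG7X §8);
nothing here asserts it. Classical mathematics (tactical decompositions, Dembowski §4.1) formalised. No `sorry`, no new axioms.
-/

namespace Summit.Ventures.DiscreteObjects.PP12

open Configuration Finset
open scoped Classical

namespace Collineation

variable {P L : Type*} [Membership P L] [ProjectivePlane P L] [Fintype P] [Fintype L] (σ : Collineation P L)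

section Flag

variable {l : L} {c : P} (hl : σ.onLines l = l) (hc : σ.onPoints c = c) (hcl : c ∈ l)
  (hP : ∀ p : P, σ.onPoints p = p → p ∈ l) (hL : ∀ m : L, σ.onLines m = m → c ∈ m)
  (h12 : ProjectivePlane.order P L = 12)

section Data

variable (hl : σ.onLines l = l) (hc : σ.onPoints c = c) (hcl : c ∈ l)
  (hP : ∀ p : P, σ.onPoints p = p → p ∈ l) (hL : ∀ m : L, σ.onLines m = m → c ∈ m) (h12 : ProjectivePlane.order P L = 12)
  (hq : σ.onPoints ^ 3 = 1) (hf : fixedCard σ.onPoints = 7) {u₀ u₁ : L} (hcu₀ : c ∈ u₀) (hu₀ : σ.onLines u₀ ≠ u₀)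
  (hcu₁ : c ∈ u₁) (hu₁ : σ.onLines u₁ ≠ u₁)

/-- **Every entry of the `f = 7` orbit matrix of a plane is an incidence count:** `entry r c = |colOrbit c ∩ lineRep r|`. -/
theorem entry_eq_card (h01 : u₁ ∉ orb3 σ.onLines u₀) (r : F7Row) (c₀ : F7Col) :
    (σ.flagSevenDataOfPlane hl hc hcl hP hL h12 hq hf hcu₀ hu₀ hcu₁ hu₁).entry r c₀
      = ((σ.colOrbit hl hc hcl hP hL h12 hq hf hcu₀ hu₀ hcu₁ hu₁ c₀).filter
          fun q => q ∈ σ.lineRep hl hc hcl hP hL h12 hq hf hcu₀ hu₀ hcu₁ hu₁ r).card := by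
  rcases r with s | ⟨s, i⟩ | ⟨k, t⟩ <;> rcases c₀ with t' | ⟨s', i'⟩ | ⟨j, t'⟩
  · exact σ.entry_eq_cline_z hl hc hcl hP hL h12 hq hf hcu₀ hu₀ hcu₁ hu₁ s t'
  · exact σ.entry_eq_cline_tri hl hc hcl hP hL h12 hq hf hcu₀ hu₀ hcu₁ hu₁ h01 s s' i'
  · exact σ.entry_eq_cline_tpt hl hc hcl hP hL h12 hq hf hcu₀ hu₀ hcu₁ hu₁ s j t'
  · exact σ.entry_eq_side_z hl hc hcl hP hL h12 hq hf hcu₀ hu₀ hcu₁ hu₁ s i t'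
  · exact σ.entry_eq_side_tri hl hc hcl hP hL h12 hq hf hcu₀ hu₀ hcu₁ hu₁ h01 s i s' i'
  · exact σ.entry_eq_side_tpt hl hc hcl hP hL h12 hq hf hcu₀ hu₀ hcu₁ hu₁ s i j t'
  · exact σ.entry_eq_tline_z hl hc hcl hP hL h12 hq hf hcu₀ hu₀ hcu₁ hu₁ k t t'
  · exact σ.entry_eq_tline_tri hl hc hcl hP hL h12 hq hf hcu₀ hu₀ hcu₁ hu₁ k t s' i'
  · exact σ.entry_eq_tline_tpt hl hc hcl hP hL h12 hq hf hcu₀ hu₀ hcu₁ hu₁ k t j t'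

/-- `Σ_{c : F7Col} g (colOrbit c) = Σ_{S ∈ orbits3 σ} g S`. -/
theorem sum_colOrbit (h01 : u₁ ∉ orb3 σ.onLines u₀) (g : Finset P → ℕ) :
    ∑ c₀ : F7Col, g (σ.colOrbit hl hc hcl hP hL h12 hq hf hcu₀ hu₀ hcu₁ hu₁ c₀) = ∑ S ∈ σ.orbits3, g S := by
  refine Finset.sum_bij (fun c₀ _ => σ.colOrbit hl hc hcl hP hL h12 hq hf hcu₀ hu₀ hcu₁ hu₁ c₀)
    (fun c₀ _ => σ.colOrbit_mem_orbits3 hl hc hcl hP hL h12 hq hf hcu₀ hu₀ hcu₁ hu₁ c₀)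
    (fun c₁ _ c₂ _ h => σ.colOrbit_injective hl hc hcl hP hL h12 hq hf hcu₀ hu₀ hcu₁ hu₁ h01 h) (fun S hS => ?_) (fun c₀ _ => rfl)
  obtain ⟨c₀, hc₀⟩ := σ.exists_colOrbit_eq hl hc hcl hP hL h12 hq hf hcu₀ hu₀ hcu₁ hu₁ h01 hS
  exact ⟨c₀, mem_univ _, hc₀⟩

/-- `Σ_{r : F7Row} g (rowOrbit r) = Σ_{B ∈ lineOrbits3 σ} g B`. -/
theorem sum_rowOrbit (h01 : u₁ ∉ orb3 σ.onLines u₀) (g : Finset L → ℕ) :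
    ∑ r : F7Row, g (σ.rowOrbit hl hc hcl hP hL h12 hq hf hcu₀ hu₀ hcu₁ hu₁ r) = ∑ B ∈ σ.lineOrbits3, g B := by
  refine Finset.sum_bij (fun r _ => σ.rowOrbit hl hc hcl hP hL h12 hq hf hcu₀ hu₀ hcu₁ hu₁ r)
    (fun r _ => σ.rowOrbit_mem_lineOrbits3 hl hc hcl hP hL h12 hq hf hcu₀ hu₀ hcu₁ hu₁ r)
    (fun r₁ _ r₂ _ h => σ.rowOrbit_injective hl hc hcl hP hL h12 hq hf hcu₀ hu₀ hcu₁ hu₁ h01 h) (fun B hB => ?_) (fun r _ => rfl)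
  obtain ⟨r, hr⟩ := σ.exists_rowOrbit_eq hl hc hcl hP hL h12 hq hf hcu₀ hu₀ hcu₁ hu₁ h01 hB
  exact ⟨r, mem_univ _, hr⟩

/-- A point generating the column orbit. -/
noncomputable def pointRep : F7Col → P
  | Sum.inl t => (mem_image.1 (σ.eZ hl hP h12 hq hf t).2).choose
  | Sum.inr (Sum.inl (s, i)) => (σ.eTri7 h12 hcu₀ hu₀ hcu₁ hu₁ s i).1
  | Sum.inr (Sum.inr (j, t)) => (mem_image.1 (σ.eOrbOn hc hcl hP hL h12 hq (σ.eFixL6 hl hc hf j) t).2).choose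

/-- `colOrbit c = orb3 (pointRep c)` and `pointRep c` is not fixed. -/
theorem colOrbit_eq_orb3_pointRep (c₀ : F7Col) :
    σ.colOrbit hl hc hcl hP hL h12 hq hf hcu₀ hu₀ hcu₁ hu₁ c₀ = orb3 σ.onPoints (σ.pointRep hl hc hcl hP hL h12 hq hf hcu₀ hu₀ hcu₁ hu₁ c₀) ∧
      σ.onPoints (σ.pointRep hl hc hcl hP hL h12 hq hf hcu₀ hu₀ hcu₁ hu₁ c₀) ≠ σ.pointRep hl hc hcl hP hL h12 hq hf hcu₀ hu₀ hcu₁ hu₁ c₀ := by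
  rcases c₀ with t | ⟨s, i⟩ | ⟨j, t⟩
  · have hspec := (mem_image.1 (σ.eZ hl hP h12 hq hf t).2).choose_spec
    rw [mem_filter] at hspec
    exact ⟨hspec.2.symm, hspec.1.2.2⟩
  · exact ⟨rfl, σ.not_fixed_of_exterior_flag hl hP (σ.exterior_of_triIdx s (σ.eTri7 h12 hcu₀ hu₀ hcu₁ hu₁ s i) hcu₀ hu₀ hcu₁ hu₁ hL)⟩
  · set m := σ.eFixL6 hl hc hf j with hm
    have hspec := (mem_image.1 (σ.eOrbOn hc hcl hP hL h12 hq m t).2).choose_spec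
    rw [mem_filter] at hspec
    refine ⟨hspec.2.symm, fun e => hspec.1.2.2 ?_⟩
    exact (Nondegenerate.eq_or_eq hspec.1.2.1 (hL m.1 m.2.1) (hP _ e) hcl).resolve_right m.2.2

/-- Entries as LINE counts: `entry r c = #{m ∈ rowOrbit r : pointRep c ∈ m}` (incidence symmetry). -/
theorem entry_eq_card_lines (h01 : u₁ ∉ orb3 σ.onLines u₀) (r : F7Row) (c₀ : F7Col) :
    (σ.flagSevenDataOfPlane hl hc hcl hP hL h12 hq hf hcu₀ hu₀ hcu₁ hu₁).entry r c₀
      = ((σ.rowOrbit hl hc hcl hP hL h12 hq hf hcu₀ hu₀ hcu₁ hu₁ r).filter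
          fun m => σ.pointRep hl hc hcl hP hL h12 hq hf hcu₀ hu₀ hcu₁ hu₁ c₀ ∈ m).card := by
  have hqL : σ.onLines ^ 3 = 1 := σ.onLines_pow_eq_one hq
  rw [σ.entry_eq_card hl hc hcl hP hL h12 hq hf hcu₀ hu₀ hcu₁ hu₁ h01 r c₀, σ.rowOrbit_eq_orb3_lineRep hl hc hcl hP hL h12 hq hf hcu₀ hu₀ hcu₁ hu₁ r]
  obtain ⟨hco, hpf⟩ := σ.colOrbit_eq_orb3_pointRep hl hc hcl hP hL h12 hq hf hcu₀ hu₀ hcu₁ hu₁ c₀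
  rw [hco]
  set p := σ.pointRep hl hc hcl hP hL h12 hq hf hcu₀ hu₀ hcu₁ hu₁ c₀ with hp
  set a := σ.lineRep hl hc hcl hP hL h12 hq hf hcu₀ hu₀ hcu₁ hu₁ r with ha
  -- the representative line is not fixed
  have hna : σ.onLines a ≠ a := by
    have hmem := σ.rowOrbit_mem_lineOrbits3 hl hc hcl hP hL h12 hq hf hcu₀ hu₀ hcu₁ hu₁ r
    rw [σ.rowOrbit_eq_orb3_lineRep hl hc hcl hP hL h12 hq hf hcu₀ hu₀ hcu₁ hu₁ r] at hmem
    unfold lineOrbits3 at hmem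
    obtain ⟨m, hm, hmeq⟩ := mem_image.1 hmem
    rw [mem_filter] at hm
    have ham : a ∈ orb3 σ.onLines m := by rw [hmeq]; exact self_mem_orb3 _ _
    rw [mem_orb3] at ham
    rcases ham with e | e | e <;> rw [e]
    · exact hm.2
    · exact fun h => hm.2 (σ.onLines.injective h)
    · exact fun h => hm.2 (σ.onLines.injective (σ.onLines.injective h))
  have hs := σ.orb3_incidence_symm hq p a
  rw [card_orb3_of_ne _ hq hpf, card_orb3_of_ne _ hqL hna] at hs
  exact (Nat.eq_of_mul_eq_mul_right (by norm_num) hs).symm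

/-- **Conjunct 6 of `IsFlagSevenOrbitMatrix`:** all row inner products are as forced by `λ = 1`. -/
theorem flagSevenDataOfPlane_rows (h01 : u₁ ∉ orb3 σ.onLines u₀) (r r' : F7Row) :
    ∑ c₀ : F7Col, (σ.flagSevenDataOfPlane hl hc hcl hP hL h12 hq hf hcu₀ hu₀ hcu₁ hu₁).entry r c₀ *
        (σ.flagSevenDataOfPlane hl hc hcl hP hL h12 hq hf hcu₀ hu₀ hcu₁ hu₁).entry r' c₀ = FlagSevenOrbitData.rowTarget r r' := by
  have hqL : σ.onLines ^ 3 = 1 := σ.onLines_pow_eq_one hq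
  -- the sum as a sum over orbits of incidence products
  have hsum : ∑ c₀ : F7Col, (σ.flagSevenDataOfPlane hl hc hcl hP hL h12 hq hf hcu₀ hu₀ hcu₁ hu₁).entry r c₀ *
        (σ.flagSevenDataOfPlane hl hc hcl hP hL h12 hq hf hcu₀ hu₀ hcu₁ hu₁).entry r' c₀
      = ∑ S ∈ σ.orbits3, (S.filter fun q => q ∈ σ.lineRep hl hc hcl hP hL h12 hq hf hcu₀ hu₀ hcu₁ hu₁ r).card * (S.filter fun q => q ∈ σ.lineRep hl hc hcl hP hL h12 hq hf hcu₀ hu₀ hcu₁ hu₁ r').card := by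
    rw [← σ.sum_colOrbit hl hc hcl hP hL h12 hq hf hcu₀ hu₀ hcu₁ hu₁ h01 (fun S => (S.filter fun q => q ∈ σ.lineRep hl hc hcl hP hL h12 hq hf hcu₀ hu₀ hcu₁ hu₁ r).card * (S.filter fun q => q ∈ σ.lineRep hl hc hcl hP hL h12 hq hf hcu₀ hu₀ hcu₁ hu₁ r').card)]
    refine Finset.sum_congr rfl fun c₀ _ => ?_
    rw [σ.entry_eq_card hl hc hcl hP hL h12 hq hf hcu₀ hu₀ hcu₁ hu₁ h01 r c₀, σ.entry_eq_card hl hc hcl hP hL h12 hq hf hcu₀ hu₀ hcu₁ hu₁ h01 r' c₀]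
  -- the representative lines: non-fixed; same orbit iff r = r'
  have hna' : σ.onLines (σ.lineRep hl hc hcl hP hL h12 hq hf hcu₀ hu₀ hcu₁ hu₁ r') ≠ σ.lineRep hl hc hcl hP hL h12 hq hf hcu₀ hu₀ hcu₁ hu₁ r' := by
    have hmem := σ.rowOrbit_mem_lineOrbits3 hl hc hcl hP hL h12 hq hf hcu₀ hu₀ hcu₁ hu₁ r'
    rw [σ.rowOrbit_eq_orb3_lineRep hl hc hcl hP hL h12 hq hf hcu₀ hu₀ hcu₁ hu₁ r'] at hmem
    unfold lineOrbits3 at hmem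
    obtain ⟨m, hm, hmeq⟩ := mem_image.1 hmem
    rw [mem_filter] at hm
    have ham : σ.lineRep hl hc hcl hP hL h12 hq hf hcu₀ hu₀ hcu₁ hu₁ r' ∈ orb3 σ.onLines m := by rw [hmeq]; exact self_mem_orb3 _ _
    rw [mem_orb3] at ham
    rcases ham with e | e | e <;> rw [e]
    · exact hm.2
    · exact fun h => hm.2 (σ.onLines.injective h)
    · exact fun h => hm.2 (σ.onLines.injective (σ.onLines.injective h))
  have hsame : σ.lineRep hl hc hcl hP hL h12 hq hf hcu₀ hu₀ hcu₁ hu₁ r ∈ orb3 σ.onLines (σ.lineRep hl hc hcl hP hL h12 hq hf hcu₀ hu₀ hcu₁ hu₁ r') ↔ r = r' := by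
    constructor
    · intro h
      apply σ.rowOrbit_injective hl hc hcl hP hL h12 hq hf hcu₀ hu₀ hcu₁ hu₁ h01
      rw [σ.rowOrbit_eq_orb3_lineRep hl hc hcl hP hL h12 hq hf hcu₀ hu₀ hcu₁ hu₁ r,
        σ.rowOrbit_eq_orb3_lineRep hl hc hcl hP hL h12 hq hf hcu₀ hu₀ hcu₁ hu₁ r']
      exact orb3_eq_of_mem σ.onLines hqL h
    · intro h; rw [h]; exact self_mem_orb3 _ _
  have hid := σ.orbit_row_identity_orbits hq hna' (σ.lineRep hl hc hcl hP hL h12 hq hf hcu₀ hu₀ hcu₁ hu₁ r)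
  rw [h12, ← hsum] at hid
  -- facts about fixed points on the three kinds of representative lines
  have fix_cl : ∀ s : Fin 2, ∀ q : P, σ.onPoints q = q → q ∈ cl u₀ u₁ s → q = c := by
    intro s q hqf hqu
    have hcs := σ.cl_spec hcu₀ hu₀ hcu₁ hu₁ s
    have hul : cl u₀ u₁ s ≠ l := fun e => hcs.2 (by rw [e, hl])
    exact (Nondegenerate.eq_or_eq hqu hcs.1 (hP q hqf) hcl).resolve_right hul
  have fix_side : ∀ (s : Fin 2) (i : Fin 12), ∀ q : P, σ.onPoints q = q → q ∉ σ.sideOf l (σ.eTri7 h12 hcu₀ hu₀ hcu₁ hu₁ s i).1 := by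
    intro s i q hqf
    set x := σ.eTri7 h12 hcu₀ hu₀ hcu₁ hu₁ s i
    have hxX := σ.exterior_of_triIdx s x hcu₀ hu₀ hcu₁ hu₁ hL
    have hxf : σ.onPoints x.1 ≠ x.1 := σ.not_fixed_of_exterior_flag hl hP hxX
    obtain ⟨hxa, hσxa⟩ := σ.sideOf_spec l hxf
    exact (σ.side_no_fixed_point hxf hxX hxa hσxa).2 q hqf
  have fix_tline : ∀ (k : Fin 6) (t : Fin 4), ∀ q : P, σ.onPoints q = q →
      q ∈ σ.lineRep hl hc hcl hP hL h12 hq hf hcu₀ hu₀ hcu₁ hu₁ (Sum.inr (Sum.inr (k, t))) → q = (σ.eFixP6 hl hc hf k).1 := by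
    intro k t q hqf hqb
    obtain ⟨hyb, hbl, -⟩ := σ.lineRep_tline_spec hl hc hcl hP hL h12 hq hf hcu₀ hu₀ hcu₁ hu₁ k t
    exact σ.tline_fixed_point_eq hP (σ.eFixP6 hl hc hf k).2.1 hyb hbl hqb hqf
  have tline_c : ∀ (k : Fin 6) (t : Fin 4), c ∉ σ.lineRep hl hc hcl hP hL h12 hq hf hcu₀ hu₀ hcu₁ hu₁ (Sum.inr (Sum.inr (k, t))) := by
    intro k t
    obtain ⟨hyb, hbl, -⟩ := σ.lineRep_tline_spec hl hc hcl hP hL h12 hq hf hcu₀ hu₀ hcu₁ hu₁ k t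
    exact σ.c_not_mem_tline hcl hP (σ.eFixP6 hl hc hf k).2.1 (σ.eFixP6 hl hc hf k).2.2 hyb hbl
  -- the common-fixed-point count F and the conclusion, by row types
  set F := (univ.filter fun q : P => q ∈ σ.lineRep hl hc hcl hP hL h12 hq hf hcu₀ hu₀ hcu₁ hu₁ r ∧ q ∈ σ.lineRep hl hc hcl hP hL h12 hq hf hcu₀ hu₀ hcu₁ hu₁ r' ∧ σ.onPoints q = q).card with hF
  have hF0 : (∀ q : P, σ.onPoints q = q → q ∈ σ.lineRep hl hc hcl hP hL h12 hq hf hcu₀ hu₀ hcu₁ hu₁ r → q ∈ σ.lineRep hl hc hcl hP hL h12 hq hf hcu₀ hu₀ hcu₁ hu₁ r' → False) → F = 0 := by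
    intro h; rw [hF, card_eq_zero, filter_eq_empty_iff]; intro q _ ⟨h1, h2, h3⟩; exact h q h3 h1 h2
  have hF1 : ∀ y : P, y ∈ σ.lineRep hl hc hcl hP hL h12 hq hf hcu₀ hu₀ hcu₁ hu₁ r → y ∈ σ.lineRep hl hc hcl hP hL h12 hq hf hcu₀ hu₀ hcu₁ hu₁ r' → σ.onPoints y = y → (∀ q : P, σ.onPoints q = q → q ∈ σ.lineRep hl hc hcl hP hL h12 hq hf hcu₀ hu₀ hcu₁ hu₁ r → q = y) → F = 1 := by
    intro y hya hya' hy huniq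
    rw [hF, card_eq_one]
    refine ⟨y, ?_⟩
    ext q
    rw [mem_filter, mem_singleton]
    constructor
    · rintro ⟨-, h1, -, h3⟩; exact huniq q h3 h1
    · intro h; rw [h]; exact ⟨mem_univ _, hya, hya', hy⟩
  rcases r with s | ⟨s, i⟩ | ⟨k, t⟩ <;> rcases r' with s' | ⟨s', i'⟩ | ⟨k', t'⟩
  · -- Γ / Γ : the common fixed point c
    have hFv : F = 1 := hF1 c (σ.cl_spec hcu₀ hu₀ hcu₁ hu₁ s).1 (σ.cl_spec hcu₀ hu₀ hcu₁ hu₁ s').1 hc (fix_cl s)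
    rw [hFv] at hid
    simp only [FlagSevenOrbitData.rowTarget]
    by_cases hss : s = s'
    · subst hss; rw [if_pos (hsame.2 rfl)] at hid; rw [if_pos rfl]; omega
    · rw [if_neg (fun h => hss (Sum.inl.inj (hsame.1 h)))] at hid; rw [if_neg hss]; omega
  · have hFv : F = 0 := hF0 (fun q hqf _ hq2 => fix_side s' i' q hqf hq2)
    rw [hFv, if_neg (fun h => by cases hsame.1 h)] at hid
    simp only [FlagSevenOrbitData.rowTarget]; omega
  · have hFv : F = 0 := hF0 (fun q hqf hq1 hq2 => by cases fix_cl s q hqf hq1; exact tline_c k' t' hq2)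
    rw [hFv, if_neg (fun h => by cases hsame.1 h)] at hid
    simp only [FlagSevenOrbitData.rowTarget]; omega
  · have hFv : F = 0 := hF0 (fun q hqf hq1 _ => fix_side s i q hqf hq1)
    rw [hFv, if_neg (fun h => by cases hsame.1 h)] at hid
    simp only [FlagSevenOrbitData.rowTarget]; omega
  · -- side / side
    have hFv : F = 0 := hF0 (fun q hqf hq1 _ => fix_side s i q hqf hq1)
    rw [hFv] at hid
    simp only [FlagSevenOrbitData.rowTarget]
    by_cases hxx : (s, i) = (s', i')
    · rw [if_pos (hsame.2 (by rw [hxx]))] at hid; rw [if_pos hxx]; omega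
    · rw [if_neg (fun h => hxx (by have := hsame.1 h; simp only [Sum.inr.injEq, Sum.inl.injEq] at this; exact this))] at hid
      rw [if_neg hxx]; omega
  · have hFv : F = 0 := hF0 (fun q hqf hq1 _ => fix_side s i q hqf hq1)
    rw [hFv, if_neg (fun h => by cases hsame.1 h)] at hid
    simp only [FlagSevenOrbitData.rowTarget]; omega
  · have hFv : F = 0 := hF0 (fun q hqf hq1 hq2 => by cases fix_cl s' q hqf hq2; exact tline_c k t hq1)
    rw [hFv, if_neg (fun h => by cases hsame.1 h)] at hid
    simp only [FlagSevenOrbitData.rowTarget]; omega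
  · have hFv : F = 0 := hF0 (fun q hqf _ hq2 => fix_side s' i' q hqf hq2)
    rw [hFv, if_neg (fun h => by cases hsame.1 h)] at hid
    simp only [FlagSevenOrbitData.rowTarget]; omega
  · -- T / T : common fixed point y_k iff k = k'
    simp only [FlagSevenOrbitData.rowTarget]
    by_cases hkk : k = k'
    · subst hkk
      obtain ⟨hyb, -, -⟩ := σ.lineRep_tline_spec hl hc hcl hP hL h12 hq hf hcu₀ hu₀ hcu₁ hu₁ k t
      obtain ⟨hyb', -, -⟩ := σ.lineRep_tline_spec hl hc hcl hP hL h12 hq hf hcu₀ hu₀ hcu₁ hu₁ k t'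
      have hFv : F = 1 := hF1 _ hyb hyb' (σ.eFixP6 hl hc hf k).2.1 (fix_tline k t)
      rw [hFv] at hid
      by_cases htt : t = t'
      · subst htt; rw [if_pos (hsame.2 rfl)] at hid; rw [if_pos rfl]; omega
      · rw [if_neg (fun h => htt (by have := hsame.1 h; simp only [Sum.inr.injEq, Prod.mk.injEq, true_and] at this; exact this))] at hid
        rw [if_neg (fun h => htt (by simp only [Prod.mk.injEq, true_and] at h; exact h)), if_pos rfl]; omega
    · have hyy : (σ.eFixP6 hl hc hf k).1 ≠ (σ.eFixP6 hl hc hf k').1 := fun e => hkk ((σ.eFixP6 hl hc hf).injective (Subtype.ext e))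
      have hFv : F = 0 := hF0 (fun q hqf hq1 hq2 => hyy ((fix_tline k t q hqf hq1).symm.trans (fix_tline k' t' q hqf hq2)))
      rw [hFv, if_neg (fun h => hkk (by have := hsame.1 h; simp only [Sum.inr.injEq, Prod.mk.injEq] at this; exact this.1))] at hid
      rw [if_neg (fun h => hkk (by simp only [Prod.mk.injEq] at h; exact h.1)), if_neg hkk]; omega

/-- **Conjunct 7 of `IsFlagSevenOrbitMatrix`:** all column inner products are as forced by `λ = 1`. -/
theorem flagSevenDataOfPlane_cols (h01 : u₁ ∉ orb3 σ.onLines u₀) (c₁ c₂ : F7Col) :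
    ∑ r : F7Row, (σ.flagSevenDataOfPlane hl hc hcl hP hL h12 hq hf hcu₀ hu₀ hcu₁ hu₁).entry r c₁ *
        (σ.flagSevenDataOfPlane hl hc hcl hP hL h12 hq hf hcu₀ hu₀ hcu₁ hu₁).entry r c₂ = FlagSevenOrbitData.colTarget c₁ c₂ := by
  set q := σ.pointRep hl hc hcl hP hL h12 hq hf hcu₀ hu₀ hcu₁ hu₁ c₁ with hqdef
  set p := σ.pointRep hl hc hcl hP hL h12 hq hf hcu₀ hu₀ hcu₁ hu₁ c₂ with hpdef
  obtain ⟨hco1, hqf⟩ := σ.colOrbit_eq_orb3_pointRep hl hc hcl hP hL h12 hq hf hcu₀ hu₀ hcu₁ hu₁ c₁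
  obtain ⟨hco2, hpf⟩ := σ.colOrbit_eq_orb3_pointRep hl hc hcl hP hL h12 hq hf hcu₀ hu₀ hcu₁ hu₁ c₂
  have hsum : ∑ r : F7Row, (σ.flagSevenDataOfPlane hl hc hcl hP hL h12 hq hf hcu₀ hu₀ hcu₁ hu₁).entry r c₁ *
        (σ.flagSevenDataOfPlane hl hc hcl hP hL h12 hq hf hcu₀ hu₀ hcu₁ hu₁).entry r c₂
      = ∑ B ∈ σ.lineOrbits3, (B.filter fun m => q ∈ m).card * (B.filter fun m => p ∈ m).card := by
    rw [← σ.sum_rowOrbit hl hc hcl hP hL h12 hq hf hcu₀ hu₀ hcu₁ hu₁ h01 (fun B => (B.filter fun m => q ∈ m).card * (B.filter fun m => p ∈ m).card)]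
    refine Finset.sum_congr rfl fun r _ => ?_
    rw [σ.entry_eq_card_lines hl hc hcl hP hL h12 hq hf hcu₀ hu₀ hcu₁ hu₁ h01 r c₁,
      σ.entry_eq_card_lines hl hc hcl hP hL h12 hq hf hcu₀ hu₀ hcu₁ hu₁ h01 r c₂]
  have hsame : q ∈ orb3 σ.onPoints p ↔ c₁ = c₂ := by
    constructor
    · intro h
      apply σ.colOrbit_injective hl hc hcl hP hL h12 hq hf hcu₀ hu₀ hcu₁ hu₁ h01
      rw [hco1, hco2]; exact orb3_eq_of_mem σ.onPoints hq h
    · intro h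
      have : q = p := by rw [hqdef, hpdef, h]
      rw [this]; exact self_mem_orb3 _ _
  have hid := σ.orbit_column_identity_orbits hq hpf q
  rw [h12, ← hsum] at hid
  -- facts: on which fixed lines do the representative points lie?
  have zfacts : ∀ t : Fin 2, σ.pointRep hl hc hcl hP hL h12 hq hf hcu₀ hu₀ hcu₁ hu₁ (Sum.inl t) ∈ l ∧
      ∀ m : L, σ.onLines m = m → σ.pointRep hl hc hcl hP hL h12 hq hf hcu₀ hu₀ hcu₁ hu₁ (Sum.inl t) ∈ m → m = l := by
    intro t
    have hrep : σ.pointRep hl hc hcl hP hL h12 hq hf hcu₀ hu₀ hcu₁ hu₁ (Sum.inl t) = (mem_image.1 (σ.eZ hl hP h12 hq hf t).2).choose := rfl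
    have hspec := (mem_image.1 (σ.eZ hl hP h12 hq hf t).2).choose_spec
    rw [mem_filter, ← hrep] at hspec
    refine ⟨hspec.1.2.1, fun m hm hzm => ?_⟩
    by_contra hml
    have hzc : σ.pointRep hl hc hcl hP hL h12 hq hf hcu₀ hu₀ hcu₁ hu₁ (Sum.inl t) = c :=
      (Nondegenerate.eq_or_eq hzm (hL m hm) hspec.1.2.1 hcl).resolve_right hml
    exact hspec.1.2.2 (by rw [hzc, hc])
  have trifacts : ∀ (s : Fin 2) (i : Fin 12), ∀ m : L, σ.onLines m = m →
      σ.pointRep hl hc hcl hP hL h12 hq hf hcu₀ hu₀ hcu₁ hu₁ (Sum.inr (Sum.inl (s, i))) ∉ m :=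
    fun s i => σ.exterior_of_triIdx s (σ.eTri7 h12 hcu₀ hu₀ hcu₁ hu₁ s i) hcu₀ hu₀ hcu₁ hu₁ hL
  have tfacts : ∀ (j : Fin 6) (t : Fin 4), σ.pointRep hl hc hcl hP hL h12 hq hf hcu₀ hu₀ hcu₁ hu₁ (Sum.inr (Sum.inr (j, t))) ∈ (σ.eFixL6 hl hc hf j).1 ∧
      ∀ m : L, σ.onLines m = m → σ.pointRep hl hc hcl hP hL h12 hq hf hcu₀ hu₀ hcu₁ hu₁ (Sum.inr (Sum.inr (j, t))) ∈ m → m = (σ.eFixL6 hl hc hf j).1 := by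
    intro j t
    have hrep : σ.pointRep hl hc hcl hP hL h12 hq hf hcu₀ hu₀ hcu₁ hu₁ (Sum.inr (Sum.inr (j, t)))
        = (mem_image.1 (σ.eOrbOn hc hcl hP hL h12 hq (σ.eFixL6 hl hc hf j) t).2).choose := rfl
    have hspec := (mem_image.1 (σ.eOrbOn hc hcl hP hL h12 hq (σ.eFixL6 hl hc hf j) t).2).choose_spec
    rw [mem_filter, ← hrep] at hspec
    refine ⟨hspec.1.2.1, fun m hm hwm' => ?_⟩
    by_contra hne
    exact hspec.1.2.2 ((Nondegenerate.eq_or_eq hwm' (hL m hm) hspec.1.2.1 (hL _ (σ.eFixL6 hl hc hf j).2.1)).resolve_right hne)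
  set G := (univ.filter fun m : L => q ∈ m ∧ p ∈ m ∧ σ.onLines m = m).card with hG
  have hG0 : (∀ m : L, σ.onLines m = m → q ∈ m → p ∈ m → False) → G = 0 := by
    intro h; rw [hG, card_eq_zero, filter_eq_empty_iff]; intro m _ ⟨h1, h2, h3⟩; exact h m h3 h1 h2
  have hG1 : ∀ m₀ : L, q ∈ m₀ → p ∈ m₀ → σ.onLines m₀ = m₀ → (∀ m : L, σ.onLines m = m → q ∈ m → m = m₀) → G = 1 := by
    intro m₀ h1 h2 h3 huniq
    rw [hG, card_eq_one]
    refine ⟨m₀, ?_⟩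
    ext m
    rw [mem_filter, mem_singleton]
    constructor
    · rintro ⟨-, hm1, -, hm3⟩; exact huniq m hm3 hm1
    · intro h; rw [h]; exact ⟨mem_univ _, h1, h2, h3⟩
  rcases c₁ with t | ⟨s, i⟩ | ⟨j, t⟩ <;> rcases c₂ with t' | ⟨s', i'⟩ | ⟨j', t'⟩
  · -- Z / Z : the common fixed line l
    have hGv : G = 1 := hG1 l (zfacts t).1 (zfacts t').1 hl (zfacts t).2
    rw [hGv] at hid
    simp only [FlagSevenOrbitData.colTarget]
    by_cases htt : t = t'
    · subst htt; rw [if_pos (hsame.2 rfl)] at hid; rw [if_pos rfl]; omega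
    · rw [if_neg (fun h => htt (Sum.inl.inj (hsame.1 h)))] at hid; rw [if_neg htt]; omega
  · have hGv : G = 0 := hG0 (fun m hm _ h2 => trifacts s' i' m hm h2)
    rw [hGv, if_neg (fun h => by cases hsame.1 h)] at hid
    simp only [FlagSevenOrbitData.colTarget]; omega
  · have hGv : G = 0 := hG0 (fun m hm h1 h2 => by
      have e1 := (zfacts t).2 m hm h1
      have e2 := (tfacts j' t').2 m hm h2
      exact (σ.eFixL6 hl hc hf j').2.2 (e2.symm.trans e1))
    rw [hGv, if_neg (fun h => by cases hsame.1 h)] at hid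
    simp only [FlagSevenOrbitData.colTarget]; omega
  · have hGv : G = 0 := hG0 (fun m hm h1 _ => trifacts s i m hm h1)
    rw [hGv, if_neg (fun h => by cases hsame.1 h)] at hid
    simp only [FlagSevenOrbitData.colTarget]; omega
  · have hGv : G = 0 := hG0 (fun m hm h1 _ => trifacts s i m hm h1)
    rw [hGv] at hid
    simp only [FlagSevenOrbitData.colTarget]
    by_cases hxx : (s, i) = (s', i')
    · rw [if_pos (hsame.2 (by rw [hxx]))] at hid; rw [if_pos hxx]; omega
    · rw [if_neg (fun h => hxx (by have := hsame.1 h; simp only [Sum.inr.injEq, Sum.inl.injEq] at this; exact this))] at hid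
      rw [if_neg hxx]; omega
  · have hGv : G = 0 := hG0 (fun m hm h1 _ => trifacts s i m hm h1)
    rw [hGv, if_neg (fun h => by cases hsame.1 h)] at hid
    simp only [FlagSevenOrbitData.colTarget]; omega
  · have hGv : G = 0 := hG0 (fun m hm h1 h2 => by
      have e1 := (tfacts j t).2 m hm h1
      have e2 := (zfacts t').2 m hm h2
      exact (σ.eFixL6 hl hc hf j).2.2 (e1.symm.trans e2))
    rw [hGv, if_neg (fun h => by cases hsame.1 h)] at hid
    simp only [FlagSevenOrbitData.colTarget]; omega
  · have hGv : G = 0 := hG0 (fun m hm _ h2 => trifacts s' i' m hm h2)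
    rw [hGv, if_neg (fun h => by cases hsame.1 h)] at hid
    simp only [FlagSevenOrbitData.colTarget]; omega
  · -- tpt / tpt : common fixed line m_j iff j = j'
    simp only [FlagSevenOrbitData.colTarget]
    by_cases hjj : j = j'
    · subst hjj
      have hGv : G = 1 := hG1 _ (tfacts j t).1 (tfacts j t').1 (σ.eFixL6 hl hc hf j).2.1 (tfacts j t).2
      rw [hGv] at hid
      by_cases htt : t = t'
      · subst htt; rw [if_pos (hsame.2 rfl)] at hid; rw [if_pos rfl]; omega
      · rw [if_neg (fun h => htt (by have := hsame.1 h; simp only [Sum.inr.injEq, Prod.mk.injEq, true_and] at this; exact this))] at hid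
        rw [if_neg (fun h => htt (by simp only [Prod.mk.injEq, true_and] at h; exact h)), if_pos rfl]; omega
    · have hmm : (σ.eFixL6 hl hc hf j).1 ≠ (σ.eFixL6 hl hc hf j').1 := fun e => hjj ((σ.eFixL6 hl hc hf).injective (Subtype.ext e))
      have hGv : G = 0 := hG0 (fun m hm h1 h2 => hmm (((tfacts j t).2 m hm h1).symm.trans ((tfacts j' t').2 m hm h2)))
      rw [hGv, if_neg (fun h => hjj (by have := hsame.1 h; simp only [Sum.inr.injEq, Prod.mk.injEq] at this; exact this.1))] at hid
      rw [if_neg (fun h => hjj (by simp only [Prod.mk.injEq] at h; exact h.1)), if_neg hjj]; omega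

/-- **All seven conjuncts:** the orbit data read off the plane satisfy `IsFlagSevenOrbitMatrix`. -/
theorem isFlagSevenOrbitMatrix_dataOfPlane (h01 : u₁ ∉ orb3 σ.onLines u₀) :
    IsFlagSevenOrbitMatrix (σ.flagSevenDataOfPlane hl hc hcl hP hL h12 hq hf hcu₀ hu₀ hcu₁ hu₁) :=
  ⟨σ.flagSevenDataOfPlane_psi_ne hl hc hcl hP hL h12 hq hf hcu₀ hu₀ hcu₁ hu₁,
    σ.flagSevenDataOfPlane_R_card hl hc hcl hP hL h12 hq hf hcu₀ hu₀ hcu₁ hu₁ h01,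
    σ.flagSevenDataOfPlane_C_card hl hc hcl hP hL h12 hq hf hcu₀ hu₀ hcu₁ hu₁,
    σ.flagSevenDataOfPlane_C_unique hl hc hcl hP hL h12 hq hf hcu₀ hu₀ hcu₁ hu₁,
    σ.flagSevenDataOfPlane_beta_bijective hl hc hcl hP hL h12 hq hf hcu₀ hu₀ hcu₁ hu₁,
    σ.flagSevenDataOfPlane_rows hl hc hcl hP hL h12 hq hf hcu₀ hu₀ hcu₁ hu₁ h01,
    σ.flagSevenDataOfPlane_cols hl hc hcl hP hL h12 hq hf hcu₀ hu₀ hcu₁ hu₁ h01⟩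

end Data

end Flag

end Collineation

/-- **The orbit-matrix reduction of the `f = 7` flag sub-cell holds** (designs g13's typed statement `FlagSevenOrbitReduction`, p327216, is a
theorem): every projective plane of order 12 with a flag-type collineation `σ ≠ 1`, `σ³ = 1`, with exactly 7 fixed points yields orbit data
satisfying `IsFlagSevenOrbitMatrix`. -/
theorem flagSevenOrbitReduction_holds : FlagSevenOrbitReduction := by
  intro P L _ _ _ _ h12 σ hq _ hflag
  obtain ⟨l, c, hl, hc, hcl, hP, hL, hf⟩ := hflag
  obtain ⟨u₀, hcu₀, hu₀⟩ := σ.exists_cline_not_fixed_seven (c := c) h12 hf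
  obtain ⟨u₁, hcu₁, hu₁, h01⟩ := σ.exists_second_cline hL h12 hq hf hu₀
  exact ⟨_, σ.isFlagSevenOrbitMatrix_dataOfPlane hl hc hcl hP hL h12 hq hf hcu₀ hu₀ hcu₁ hu₁ h01⟩

/-- **Census consequence (pure logic):** if no orbit matrix of the `f = 7` flag sub-cell exists (`NoFlagSevenOrbitMatrix` — UNDECIDED as of
2026-08-22), then no projective plane of order 12 admits a flag-type collineation of order 3 with exactly 7 fixed points. -/
theorem noFlagSevenFixed_of_noOrbitMatrix (hno : NoFlagSevenOrbitMatrix) : NoFlagOrder3Order12Fixed 7 :=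
  noFlagSeven_of_orbitReduction flagSevenOrbitReduction_holds hno

end Summit.Ventures.DiscreteObjects.PP12
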